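import Mathlib.Analysis.Calculus.FDeriv.Bilinear
import Mathlib.Analysis.Calculus.FDeriv.Symmetric
import Mathlib.Analysis.Calculus.ContDiff.Operations
import HarnessLib

/-!
# S6-JET: the Taylor remainder beyond the Hessian — `R(x) := f(x) − f(0) − Df(0)x − ½·D²f(0)(x,x)` has `R(0) = 0`, `D¹R(0) = 0`, `D²R(0) = 0` and `D³R = D³f`
# (so FILE `…VertexScaling`'s jet hypotheses are DISCHARGED from `ContDiff ℝ 3 f` and one bound on `‖D³f‖` alone)

Cell `ym3-torus` (YM ladder rung R3 = continuum `SU(2)` Yang–Mills on the three-torus — a RUNG, NOT d = 4, NOT infinite volume, NOT a mass gap, NOT Clay).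
Width seat `ym3-torus-px20` (gen 16); `--supports stmt-QuantumFields-20520 --as helper`, count-neutral, definition-free, default heartbeats; registry v11.4 №36
untouched.  The vertex of BLUEPRINT-ECE₁ S6 is `V_β(φ) = β·R((√β)⁻¹φ)` with `R` THE TAYLOR REMAINDER OF THE ACTION (in chart coordinates) BEYOND ITS HESSIAN at the
minimiser; FILE `…LoopLedgerVertexScaling.vertex_table_of_jet` asks `R 0 = 0`, `iteratedFDeriv ℝ 1 R 0 = 0`, `iteratedFDeriv ℝ 2 R 0 = 0` and `‖iteratedFDeriv ℝ 3 R ψ‖ ≤ M`, and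
FILE `…LoopLedgerGaussianScaling.integral_mul_exp_neg_mul_action_mul_exp_eq` asks the split `A x = m + ⟨x,Hx⟩∕2 + R x`.  This file proves, for ANY `Cᴺ` function `f` on a
real normed space (`N ≥ 2`, resp. `≥ 3`) and the SYMMETRIC Hessian letter `B := fderiv ℝ (fderiv ℝ f) 0` (the (T)-chain's ∕ FILE `…HessianCoordinates`' letter), that the
remainder so DEFINED has exactly those jets:
* §1 the quadratic part of a symmetric continuous bilinear letter: `hasFDerivAt_quadHalf` (`D(½B(x,x)) = B x`), `fderiv_quadHalf` (`= ⇑B`), `fderiv_fderiv_quadHalf` (`= B`),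
  `contDiff_quadHalf`, `iteratedFDeriv_two_clm_eq_zero` (a continuous LINEAR map has vanishing iterated derivatives of order `≥ 2`), `iteratedFDeriv_three_quadHalf_eq_zero`.
* §2 the remainder: `taylorSplit` (`f x = f 0 + Df(0) x + ½B(x,x) + R x`, by definition), ★`remainder_zero`, ★`fderiv_remainder_zero` ∕ `iteratedFDeriv_one_remainder_zero`,
  ★`fderiv_fderiv_remainder_zero` ∕ `iteratedFDeriv_two_remainder_zero`, ★★`iteratedFDeriv_three_remainder_eq` (`D³R = D³f` everywhere), `contDiff_remainder`.
* §3 at a CRITICAL point (`fderiv ℝ f 0 = 0`, the minimiser): ★★`taylorSplit_of_isCrit` (`f x = f 0 + ½·B x x + R x` — FILE 1 §4's `hA` shape with `m := f 0` once `B x x` is read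
  in coordinates by FILE 2's `hess_quadForm_eq`), and the packaged jet ★★`remainder_jet_of_contDiff` (all four jet facts + `‖D³R ψ‖ ≤ M ⟸ ‖D³f ψ‖ ≤ M`).

HONEST SCOPE.  [folklore] second-order Taylor bookkeeping with Mathlib's `fderiv`; nothing of the chart, of HESS-POS, of the bound on `D³(A∘Ψ)` (the analytic input), of GREP∕GBND,
of Bałaban's expansions, of GAS∕GAS₁∕REP∕H4ᶜ∕S2β or of `FluctuationComparisonRegPrIntL` (stmt-QuantumFields-20520) is proved; no summit statement is proved by a helper; rung R3 =
SU(2) YM₃ on T³ — NOT d = 4, NOT infinite volume, NOT a mass gap, NOT Clay; the Yang–Mills mass gap is NOT proved.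

References: T. Bałaban, CMP **102** (1985) 255–275 [Balaban1985UV3] ((45)–(47)); D. C. Brydges, Les Houches 1984 [Brydges1986] §3.
-/

set_option autoImplicit false

noncomputable section

namespace Summit.QuantumFields.YangMills.Theorems.LoopLedgerTaylorJet

variable {E : Type*} [NormedAddCommGroup E] [NormedSpace ℝ E]

/-! ## §1 The quadratic part of a symmetric bilinear letter -/

/-- `x ↦ ½·B(x,x)` has derivative `B x` at `x` when `B` is symmetric. [folklore] -/
theorem hasFDerivAt_quadHalf (B : E →L[ℝ] E →L[ℝ] ℝ) (hB : ∀ u v, B u v = B v u) (x : E) :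
    HasFDerivAt (fun y : E => B y y / 2) (B x) x := by
  have h := (B.hasFDerivAt_of_bilinear (hasFDerivAt_id x) (hasFDerivAt_id x)).const_smul (2 : ℝ)⁻¹
  have hfun : (fun y : E => B y y / 2) = fun y => (2 : ℝ)⁻¹ • B (id y) (id y) := by
    funext y
    rw [smul_eq_mul, div_eq_inv_mul]
    rfl
  rw [hfun]
  refine h.congr_fderiv ?_
  ext h'
  simp only [smul_apply, add_apply, ContinuousLinearMap.precompR_apply, ContinuousLinearMap.precompL_apply,
    ContinuousLinearMap.compL_apply, ContinuousLinearMap.coe_comp, Function.comp_apply, ContinuousLinearMap.coe_id', id, smul_eq_mul]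
  rw [hB h' x]
  ring

/-- hence `fderiv (½B(x,x)) = ⇑B` as a function. [folklore] -/
theorem fderiv_quadHalf (B : E →L[ℝ] E →L[ℝ] ℝ) (hB : ∀ u v, B u v = B v u) :
    fderiv ℝ (fun y : E => B y y / 2) = fun x => B x :=
  funext fun x => (hasFDerivAt_quadHalf B hB x).fderiv

/-- the quadratic part is differentiable. [folklore] -/
theorem differentiable_quadHalf (B : E →L[ℝ] E →L[ℝ] ℝ) (hB : ∀ u v, B u v = B v u) :
    Differentiable ℝ (fun y : E => B y y / 2) :=
  fun x => (hasFDerivAt_quadHalf B hB x).differentiableAt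

/-- the second derivative of `½B(x,x)` is the constant letter `B`. [folklore] -/
theorem fderiv_fderiv_quadHalf (B : E →L[ℝ] E →L[ℝ] ℝ) (hB : ∀ u v, B u v = B v u) (x : E) :
    fderiv ℝ (fderiv ℝ (fun y : E => B y y / 2)) x = B := by
  rw [fderiv_quadHalf B hB]
  exact B.fderiv

/-- the quadratic part is smooth. [folklore] -/
theorem contDiff_quadHalf (B : E →L[ℝ] E →L[ℝ] ℝ) {N : WithTop ℕ∞} : ContDiff ℝ N (fun y : E => B y y / 2) :=
  (B.isBoundedBilinearMap.contDiff.comp (contDiff_id.prodMk contDiff_id)).div_const 2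

/-- a continuous LINEAR map has vanishing iterated derivatives of every order `≥ 2`. [folklore] -/
theorem iteratedFDeriv_clm_eq_zero {G : Type*} [NormedAddCommGroup G] [NormedSpace ℝ G] (L : E →L[ℝ] G) (n : ℕ) :
    iteratedFDeriv ℝ (n + 2) (fun y : E => L y) = 0 := by
  funext x
  ext m
  rw [iteratedFDeriv_succ_apply_right]
  have hL : (fun y : E => fderiv ℝ (fun y : E => L y) y) = fun _ => L := by
    funext y
    exact L.fderiv
  rw [hL, iteratedFDeriv_succ_const]
  rfl

/-- the quadratic part of a symmetric letter has vanishing third derivative. [folklore] -/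
theorem iteratedFDeriv_three_quadHalf_eq_zero (B : E →L[ℝ] E →L[ℝ] ℝ) (hB : ∀ u v, B u v = B v u) :
    iteratedFDeriv ℝ 3 (fun y : E => B y y / 2) = 0 := by
  funext x
  ext m
  rw [iteratedFDeriv_succ_apply_right, fderiv_quadHalf B hB, iteratedFDeriv_clm_eq_zero B 0]
  rfl

/-! ## §2 The remainder beyond the Hessian -/

/-- the Taylor split is the DEFINITION of the remainder: `f x = f 0 + Df(0) x + ½B(x,x) + R x` with `R x := f x − f 0 − Df(0) x − ½B(x,x)`. [folklore] -/
theorem taylorSplit (f : E → ℝ) (B : E →L[ℝ] E →L[ℝ] ℝ) (x : E) :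
    f x = f 0 + fderiv ℝ f 0 x + B x x / 2 + (f x - f 0 - fderiv ℝ f 0 x - B x x / 2) := by ring

/-- ★ `R(0) = 0`. [folklore] -/
theorem remainder_zero (f : E → ℝ) (B : E →L[ℝ] E →L[ℝ] ℝ) :
    (fun x => f x - f 0 - fderiv ℝ f 0 x - B x x / 2) 0 = 0 := by
  simp only [map_zero, zero_div, sub_self]

/-- the remainder is as smooth as `f`. [folklore] -/
theorem contDiff_remainder {f : E → ℝ} {N : WithTop ℕ∞} (hf : ContDiff ℝ N f) (B : E →L[ℝ] E →L[ℝ] ℝ) :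
    ContDiff ℝ N (fun x => f x - f 0 - fderiv ℝ f 0 x - B x x / 2) :=
  ((hf.sub contDiff_const).sub (fderiv ℝ f 0).contDiff).sub (contDiff_quadHalf B)

/-- the derivative of the remainder, everywhere: `DR(x) = Df(x) − Df(0) − B x` (`f` differentiable, `B` symmetric). [folklore] -/
theorem hasFDerivAt_remainder {f : E → ℝ} (hf : Differentiable ℝ f) (B : E →L[ℝ] E →L[ℝ] ℝ) (hB : ∀ u v, B u v = B v u) (x : E) :
    HasFDerivAt (fun x => f x - f 0 - fderiv ℝ f 0 x - B x x / 2) (fderiv ℝ f x - fderiv ℝ f 0 - B x) x := by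
  have h1 : HasFDerivAt (fun x => f x - f 0) (fderiv ℝ f x) x := (hf x).hasFDerivAt.sub_const (f 0)
  have h2 : HasFDerivAt (fun x : E => fderiv ℝ f 0 x) (fderiv ℝ f 0) x := (fderiv ℝ f 0).hasFDerivAt
  exact (h1.sub h2).sub (hasFDerivAt_quadHalf B hB x)

/-- `fderiv R` as a function. [folklore] -/
theorem fderiv_remainder {f : E → ℝ} (hf : Differentiable ℝ f) (B : E →L[ℝ] E →L[ℝ] ℝ) (hB : ∀ u v, B u v = B v u) :
    fderiv ℝ (fun x => f x - f 0 - fderiv ℝ f 0 x - B x x / 2) = fun x => fderiv ℝ f x - fderiv ℝ f 0 - B x :=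
  funext fun x => (hasFDerivAt_remainder hf B hB x).fderiv

/-- ★ `D¹R(0) = 0`. [folklore] -/
theorem fderiv_remainder_zero {f : E → ℝ} (hf : Differentiable ℝ f) (B : E →L[ℝ] E →L[ℝ] ℝ) (hB : ∀ u v, B u v = B v u) :
    fderiv ℝ (fun x => f x - f 0 - fderiv ℝ f 0 x - B x x / 2) 0 = 0 := by
  rw [fderiv_remainder hf B hB]
  simp only [map_zero, sub_self]

/-- the same in `iteratedFDeriv ℝ 1` currency (FILE `…VertexScaling`'s `h1`). [folklore] -/
theorem iteratedFDeriv_one_remainder_zero {f : E → ℝ} (hf : Differentiable ℝ f) (B : E →L[ℝ] E →L[ℝ] ℝ) (hB : ∀ u v, B u v = B v u) :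
    iteratedFDeriv ℝ 1 (fun x => f x - f 0 - fderiv ℝ f 0 x - B x x / 2) 0 = 0 := by
  ext m
  rw [iteratedFDeriv_one_apply, fderiv_remainder_zero hf B hB]
  rfl

/-- ★ `D²R(0) = 0` when `B = D²f(0)`: the Hessian letter is subtracted exactly (`f` of class `C²`). [folklore] -/
theorem fderiv_fderiv_remainder_zero {f : E → ℝ} {N : WithTop ℕ∞} (hf : ContDiff ℝ N f) (h2 : (2 : WithTop ℕ∞) ≤ N)
    (hB : ∀ u v, fderiv ℝ (fderiv ℝ f) 0 u v = fderiv ℝ (fderiv ℝ f) 0 v u) :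
    fderiv ℝ (fderiv ℝ (fun x => f x - f 0 - fderiv ℝ f 0 x - fderiv ℝ (fderiv ℝ f) 0 x x / 2)) 0 = 0 := by
  have hf2 : ContDiff ℝ 2 f := hf.of_le h2
  have hdf : Differentiable ℝ f := hf2.differentiable (by norm_num)
  have hddf : DifferentiableAt ℝ (fderiv ℝ f) 0 :=
    (hf2.differentiable_iteratedFDeriv (m := 1) (by norm_cast)).differentiableAt |> fun h => by
      have e : (fun x => fderiv ℝ f x) = fun x => (continuousMultilinearCurryFin1 ℝ E ℝ) (iteratedFDeriv ℝ 1 f x) := by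
        funext x; ext v; simp [iteratedFDeriv_one_apply]
      rw [show fderiv ℝ f = fun x => fderiv ℝ f x from rfl, e]
      exact (continuousMultilinearCurryFin1 ℝ E ℝ).toContinuousLinearEquiv.toContinuousLinearMap.differentiableAt.comp 0 h
  rw [fderiv_remainder hdf _ hB]
  have h3 : HasFDerivAt (fun x => fderiv ℝ f x - fderiv ℝ f 0 - fderiv ℝ (fderiv ℝ f) 0 x)
      (fderiv ℝ (fderiv ℝ f) 0 - fderiv ℝ (fderiv ℝ f) 0) 0 :=
    (hddf.hasFDerivAt.sub_const _).sub (fderiv ℝ (fderiv ℝ f) 0).hasFDerivAt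
  rw [h3.fderiv, sub_self]

/-- the same in `iteratedFDeriv ℝ 2` currency (FILE `…VertexScaling`'s `h2`). [folklore] -/
theorem iteratedFDeriv_two_remainder_zero {f : E → ℝ} {N : WithTop ℕ∞} (hf : ContDiff ℝ N f) (h2 : (2 : WithTop ℕ∞) ≤ N)
    (hB : ∀ u v, fderiv ℝ (fderiv ℝ f) 0 u v = fderiv ℝ (fderiv ℝ f) 0 v u) :
    iteratedFDeriv ℝ 2 (fun x => f x - f 0 - fderiv ℝ f 0 x - fderiv ℝ (fderiv ℝ f) 0 x x / 2) 0 = 0 := by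
  ext m
  rw [iteratedFDeriv_two_apply, fderiv_fderiv_remainder_zero hf h2 hB]
  rfl

/-- ★★ `D³R = D³f` EVERYWHERE: the subtracted constant, linear and quadratic parts have no third derivative (`f` of class `C³`, `B` symmetric). [folklore] -/
theorem iteratedFDeriv_three_remainder_eq {f : E → ℝ} {N : WithTop ℕ∞} (hf : ContDiff ℝ N f) (h3 : (3 : WithTop ℕ∞) ≤ N)
    (B : E →L[ℝ] E →L[ℝ] ℝ) (hB : ∀ u v, B u v = B v u) (x : E) :
    iteratedFDeriv ℝ 3 (fun x => f x - f 0 - fderiv ℝ f 0 x - B x x / 2) x = iteratedFDeriv ℝ 3 f x := by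
  have hf3 : ContDiff ℝ 3 f := hf.of_le h3
  have hA : ContDiff ℝ 3 (fun x => f x - f 0) := hf3.sub contDiff_const
  have hL : ContDiff ℝ 3 (fun x : E => fderiv ℝ f 0 x) := (fderiv ℝ f 0).contDiff
  have hQ : ContDiff ℝ 3 (fun y : E => B y y / 2) := contDiff_quadHalf B
  have e1 : iteratedFDeriv ℝ 3 (fun x => f x - f 0 - fderiv ℝ f 0 x - B x x / 2) x
      = iteratedFDeriv ℝ 3 (fun x => f x - f 0 - fderiv ℝ f 0 x) x - iteratedFDeriv ℝ 3 (fun y : E => B y y / 2) x :=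
    iteratedFDeriv_sub_apply (hA.sub hL).contDiffAt hQ.contDiffAt
  have e2 : iteratedFDeriv ℝ 3 (fun x => f x - f 0 - fderiv ℝ f 0 x) x
      = iteratedFDeriv ℝ 3 (fun x => f x - f 0) x - iteratedFDeriv ℝ 3 (fun x : E => fderiv ℝ f 0 x) x :=
    iteratedFDeriv_sub_apply hA.contDiffAt hL.contDiffAt
  have e3 : iteratedFDeriv ℝ 3 (fun x => f x - f 0) x = iteratedFDeriv ℝ 3 f x - iteratedFDeriv ℝ 3 (fun _ : E => f 0) x :=
    iteratedFDeriv_sub_apply hf3.contDiffAt contDiff_const.contDiffAt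
  rw [e1, e2, e3, iteratedFDeriv_three_quadHalf_eq_zero B hB, iteratedFDeriv_clm_eq_zero (fderiv ℝ f 0) 1, iteratedFDeriv_succ_const]
  simp only [Pi.zero_apply, sub_zero]

/-! ## §3 At a critical point -/

/-- ★★ **the split at a critical point**: `Df(0) = 0` ⟹ `f x = f 0 + ½·D²f(0)(x,x) + R x` — the `hA : ∀ x, A x = m + (x ⬝ᵥ (H *ᵥ x)) ∕ 2 + R x` shape of
✓`…LoopLedgerGaussianScaling.integral_mul_exp_neg_mul_action_mul_exp_eq` with `m := f 0`, once `D²f(0)(x,x)` is read in coordinates (✓`…LoopLedgerHessianCoordinates.hess_quadForm_eq`).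
[folklore] -/
theorem taylorSplit_of_isCrit {f : E → ℝ} (hcrit : fderiv ℝ f 0 = 0) (x : E) :
    f x = f 0 + fderiv ℝ (fderiv ℝ f) 0 x x / 2 + (f x - f 0 - fderiv ℝ f 0 x - fderiv ℝ (fderiv ℝ f) 0 x x / 2) := by
  rw [hcrit]
  simp only [zero_apply, sub_zero]
  ring

/-- ★★ **THE JET OF THE REMAINDER (all of FILE `…VertexScaling.vertex_table_of_jet`'s hypotheses from `ContDiff ℝ N f`, `N ≥ 3`, and ONE bound on `‖D³f‖`).**  With
`B := fderiv ℝ (fderiv ℝ f) 0` and `R x := f x − f 0 − Df(0) x − ½·B x x`: `R 0 = 0`, `iteratedFDeriv ℝ 1 R 0 = 0`, `iteratedFDeriv ℝ 2 R 0 = 0`, and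
`‖iteratedFDeriv ℝ 3 f ψ‖ ≤ M → ‖iteratedFDeriv ℝ 3 R ψ‖ ≤ M` for every `ψ`. [folklore] -/
theorem remainder_jet_of_contDiff {f : E → ℝ} {N : WithTop ℕ∞} (hf : ContDiff ℝ N f) (h3 : (3 : WithTop ℕ∞) ≤ N) :
    (fun x => f x - f 0 - fderiv ℝ f 0 x - fderiv ℝ (fderiv ℝ f) 0 x x / 2) 0 = 0 ∧
    iteratedFDeriv ℝ 1 (fun x => f x - f 0 - fderiv ℝ f 0 x - fderiv ℝ (fderiv ℝ f) 0 x x / 2) 0 = 0 ∧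
    iteratedFDeriv ℝ 2 (fun x => f x - f 0 - fderiv ℝ f 0 x - fderiv ℝ (fderiv ℝ f) 0 x x / 2) 0 = 0 ∧
    ∀ (M : ℝ) (ψ : E), ‖iteratedFDeriv ℝ 3 f ψ‖ ≤ M →
      ‖iteratedFDeriv ℝ 3 (fun x => f x - f 0 - fderiv ℝ f 0 x - fderiv ℝ (fderiv ℝ f) 0 x x / 2) ψ‖ ≤ M := by
  have h2 : (2 : WithTop ℕ∞) ≤ N := le_trans (by exact_mod_cast (by norm_num : (2 : ℕ) ≤ 3)) h3
  have hB : ∀ u v, fderiv ℝ (fderiv ℝ f) 0 u v = fderiv ℝ (fderiv ℝ f) 0 v u :=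
    fun u v => (hf.of_le h2).contDiffAt.isSymmSndFDerivAt (by simp) u v
  have hdf : Differentiable ℝ f := (hf.of_le h2).differentiable (by norm_num)
  refine ⟨remainder_zero f _, iteratedFDeriv_one_remainder_zero hdf _ hB, iteratedFDeriv_two_remainder_zero hf h2 hB, fun M ψ hM => ?_⟩
  rw [iteratedFDeriv_three_remainder_eq hf h3 _ hB ψ]
  exact hM

/-! ## §4 (appended, v1.1) ALL orders `≥ 3`: `DⁿR = Dⁿf` — the quadratic part has no derivatives of order `≥ 3`

GREP's poly-growth class and FILE `…VertexScaling`'s `norm_iteratedFDeriv_vertex_le_of_three_le` read the jets of the vertex at EVERY order `k ≥ 3`; for the remainder beyond the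
Hessian these are the jets of `f` itself. -/

/-- the quadratic part of a symmetric letter has vanishing derivatives of every order `≥ 3`. [folklore] -/
theorem iteratedFDeriv_quadHalf_eq_zero_of_three_le (B : E →L[ℝ] E →L[ℝ] ℝ) (hB : ∀ u v, B u v = B v u) (n : ℕ) :
    iteratedFDeriv ℝ (n + 3) (fun y : E => B y y / 2) = 0 := by
  funext x
  ext m
  rw [iteratedFDeriv_succ_apply_right, fderiv_quadHalf B hB, iteratedFDeriv_clm_eq_zero B n]
  rfl

/-- ★★ `DⁿR = Dⁿf` for EVERY `n ≥ 3` (`f` of class `Cᴺ`, `n ≤ N`, `B` symmetric). [folklore] -/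
theorem iteratedFDeriv_remainder_eq_of_three_le {f : E → ℝ} {N : WithTop ℕ∞} (hf : ContDiff ℝ N f) {n : ℕ} (hnN : (((n + 3 : ℕ)) : WithTop ℕ∞) ≤ N)
    (B : E →L[ℝ] E →L[ℝ] ℝ) (hB : ∀ u v, B u v = B v u) (x : E) :
    iteratedFDeriv ℝ (n + 3) (fun x => f x - f 0 - fderiv ℝ f 0 x - B x x / 2) x = iteratedFDeriv ℝ (n + 3) f x := by
  have hfn : ContDiff ℝ (n + 3 : ℕ) f := hf.of_le hnN
  have hA : ContDiff ℝ (n + 3 : ℕ) (fun x => f x - f 0) := hfn.sub contDiff_const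
  have hL : ContDiff ℝ (n + 3 : ℕ) (fun x : E => fderiv ℝ f 0 x) := (fderiv ℝ f 0).contDiff
  have hQ : ContDiff ℝ (n + 3 : ℕ) (fun y : E => B y y / 2) := contDiff_quadHalf B
  have e1 : iteratedFDeriv ℝ (n + 3) (fun x => f x - f 0 - fderiv ℝ f 0 x - B x x / 2) x
      = iteratedFDeriv ℝ (n + 3) (fun x => f x - f 0 - fderiv ℝ f 0 x) x - iteratedFDeriv ℝ (n + 3) (fun y : E => B y y / 2) x :=
    iteratedFDeriv_sub_apply (hA.sub hL).contDiffAt hQ.contDiffAt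
  have e2 : iteratedFDeriv ℝ (n + 3) (fun x => f x - f 0 - fderiv ℝ f 0 x) x
      = iteratedFDeriv ℝ (n + 3) (fun x => f x - f 0) x - iteratedFDeriv ℝ (n + 3) (fun x : E => fderiv ℝ f 0 x) x :=
    iteratedFDeriv_sub_apply hA.contDiffAt hL.contDiffAt
  have e3 : iteratedFDeriv ℝ (n + 3) (fun x => f x - f 0) x = iteratedFDeriv ℝ (n + 3) f x - iteratedFDeriv ℝ (n + 3) (fun _ : E => f 0) x :=
    iteratedFDeriv_sub_apply hfn.contDiffAt contDiff_const.contDiffAt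
  rw [e1, e2, e3, iteratedFDeriv_quadHalf_eq_zero_of_three_le B hB n, iteratedFDeriv_clm_eq_zero (fderiv ℝ f 0) (n + 1), iteratedFDeriv_succ_const]
  simp only [Pi.zero_apply, sub_zero]

/-- ★★ the all-order jet package at the Hessian letter `B := D²f(0)`: for every `n ≥ 3` with `n ≤ N`, `‖Dⁿf ψ‖ ≤ M → ‖DⁿR ψ‖ ≤ M` (FILE `…VertexScaling`'s `hMk` inputs at
every order from those of `f`). [folklore] -/
theorem norm_iteratedFDeriv_remainder_le_of_three_le {f : E → ℝ} {N : WithTop ℕ∞} (hf : ContDiff ℝ N f) {n : ℕ} (hnN : (((n + 3 : ℕ)) : WithTop ℕ∞) ≤ N)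
    {M : ℝ} (ψ : E) (hM : ‖iteratedFDeriv ℝ (n + 3) f ψ‖ ≤ M) :
    ‖iteratedFDeriv ℝ (n + 3) (fun x => f x - f 0 - fderiv ℝ f 0 x - fderiv ℝ (fderiv ℝ f) 0 x x / 2) ψ‖ ≤ M := by
  have h2 : (2 : WithTop ℕ∞) ≤ N := le_trans (by exact_mod_cast (by omega : 2 ≤ n + 3)) hnN
  have hB : ∀ u v, fderiv ℝ (fderiv ℝ f) 0 u v = fderiv ℝ (fderiv ℝ f) 0 v u :=
    fun u v => (hf.of_le h2).contDiffAt.isSymmSndFDerivAt (by simp) u v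
  rw [iteratedFDeriv_remainder_eq_of_three_le hf hnN _ hB ψ]
  exact hM

end Summit.QuantumFields.YangMills.Theorems.LoopLedgerTaylorJet

end
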